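import Literature.MathematicalPhysics.QuantumLattice.TorusSectorPressureTypeBoundFillingBox
import Literature.MathematicalPhysics.QuantumLattice.TorusSectorGibbsEntropyRowPressureFloors
import Literature.MathematicalPhysics.QuantumLattice.HubbardThermalAxisWindow
import HarnessLib

/-!
# Pressure floors for the entropy rows on EVERY torus: the single-box floor, the purity-box floor and the
# «ent» / «cent» rows without box-compatibility of the side sequence

Topic `MathematicalPhysics/QuantumLattice`; the all-tori companion of `TorusSectorGibbsEntropyRowPressureFloors`
(hubbard-thermal p1) and `TorusSectorGibbsPurityBoxBound` (p2). There the purity-box pressure floor and the rows fed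
by it carry `hbox : ∀ᶠ j, ∃ K, 2 ≤ K ∧ Ls j = K a ∧ halfRectN n (Ls j) = K² a₀` — box-built tori only, a sub-class
of the thermal convention of record. A single box sector `(a₀, a₀)` is the base type `m = δ_{(a₀,a₀)}` (`q = 1`,
`A₀ = a₀`) of the type-class certificate, so `InfVolFermionState.eventually_typeFreeEntropy_mul_sq_le_log_partitionFn_allTori`
(`TorusSectorPressureTypeBoundAllTori`) gives the same floor along EVERY `Ls → ∞`, with `hbox` replaced by the
density identity `n · (a b) = 2 a₀`:

* §1 `eventually_pressureFloor_of_openBox_allTori` — one certified `0 < z ≤ Re Z_β(H^open_{a×b}; a₀, a₀)` ⇒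
  `∀ ε > 0, ∀ᶠ j, (log z/(ab) − ε)(Ls j)² ≤ log Re Z_β(sectorHamiltonianTT' t t' U n (Ls j))`, any `Ls → ∞`;
  `eventually_pressureFloor_of_purityBox_allTori` — the same from a box density matrix with certified energy `E`
  and purity `P` (`W = −(log P + βE)/(ab)`); `eventually_pressureFloor_of_twoBoxes_allTori` — two box sectors
  `(p₁,p₁)`, `(p₂,p₂)` with floors `z₁, z₂` give the CHORD `(1−λ) log z₁/(ab) + λ log z₂/(ab)` at the
  non-commensurate density `n(ab) = 2((1−λ)p₁ + λp₂)` (two base types `δ_{(p_i,p_i)}`,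
  `TorusSectorPressureTypeBoundFillingBox`).
* §2 the «ent» / «cent» torus-limit rows with a purity-box input for EVERY torus limit
  (`…_box_of_purityBox_allTori`, `…_window_of_purityBox_allTori`), the certified upper edge of the thermal energy
  window from a purity box and a hot pressure bound (`…le_chord_of_purityBox_allTori`), and the `n = 7/8`, `4 × 4`,
  `(7,7)` instance of the «ent» row along ANY `Ls → ∞` (`…_seven_eighths_allTori`).

Everything is PROVED; no definition, no named fact.

## References

* D. Ruelle, *Statistical Mechanics: Rigorous Results* (1969), §3.3 eqs. (3.11)–(3.18). [cite: Ruelle1969, §3.3 (3.11)–(3.18)]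
* R. B. Israel, *Convexity in the Theory of Lattice Gases* (1979), Lemma II.3.1. [cite: Israel1979, Lemma II.3.1]
* H. Araki, H. Moriya, Rev. Math. Phys. 15 (2003) 93, Thm. 3.8 and §10. [cite: ArakiMoriya2003, Theorem 3.8 and §10]
* D. Poulin, M. B. Hastings, Phys. Rev. Lett. 106 (2011) 080403, eqs. (3)–(8). [cite: PoulinHastings2011, eqs. (3)–(8)]
* J. P. F. LeBlanc et al., Phys. Rev. X 5 (2015) 041041, eq. (1). [cite: LeBlancEtAl2015, eq. (1)]
-/

noncomputable section

namespace Literature.MathematicalPhysics.QuantumLattice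

open Matrix Finset HubbardWave0 ThermodynamicLimit LiebThm1 AddMonoidAlgebra Literature.Probability.LatticeModels
open Literature.InformationTheory.Entropy (vonNeumannEntropy)
open _root_.Filter
open scoped _root_.Topology ComplexOrder BigOperators

/-! ### §1 One box sector is a type with `q = 1`: the single-box and purity-box floors on every torus -/

/-- **Single-box pressure floor along EVERY `Ls → ∞`.** `β ≥ 0`, open `a × b` box (`a, b ≥ 1`), one sector
`(a₀, a₀)` of density `n (a b) = 2 a₀` (`n ≤ 2`) with a certified floor `0 < z ≤ Re Z_β(H^open_{a×b}(t,t',U); a₀, a₀)`.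
Then for every `ε > 0`, eventually `(log z/(ab) − ε)(Ls j)² ≤ log Re Z_β(sectorHamiltonianTT' t t' U n (Ls j))` — the
type-class certificate with the base type `δ_{(a₀,a₀)}`. [cite: Ruelle1969, §3.3 (3.11)–(3.18)]
[cite: Israel1979, Lemma II.3.1] -/
theorem eventually_pressureFloor_of_openBox_allTori (t t' U n : ℝ) {β : ℝ} (hβ : 0 ≤ β) {a b a₀ : ℕ}
    (ha : 1 ≤ a) (hb : 1 ≤ b) (hn : n * ((a : ℝ) * b) = 2 * a₀) (hn2 : n ≤ 2) {z : ℝ} (hz0 : 0 < z)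
    (hz : z ≤ (partitionFn β (spinSectorHamiltonian a₀ a₀ (hubbardOpenBoxTT' a b t t' U))).re)
    {Ls : ℕ → ℕ} (hLs : Tendsto Ls atTop atTop) {ε : ℝ} (hε : 0 < ε) :
    ∀ᶠ j in atTop, (Real.log z / ((a : ℝ) * b) - ε) * (Ls j : ℝ) ^ 2 ≤
      Real.log (partitionFn β (sectorHamiltonianTT' t t' U n (Ls j))).re := by
  classical
  have h := InfVolFermionState.eventually_typeFreeEntropy_mul_sq_le_log_partitionFn_allTori t t' U n hβ ha hb
    ({(a₀, a₀)} : Finset (ℕ × ℕ)) (fun s => if s = (a₀, a₀) then 1 else 0) (q := 1) (A₀ := a₀) le_rfl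
    (fun s hs => by
      rw [Finset.mem_singleton]
      by_contra h
      exact hs (if_neg h))
    (by simp) (by simp) (by simp) (by push_cast; linarith) hn2 (z := fun _ => z) (fun _ _ => hz0)
    (fun s hs => by rw [Finset.mem_singleton.1 hs]; exact hz) hLs hε
  have e : (((1 : ℕ) : ℝ) * Real.log ((1 : ℕ) : ℝ) -
      ∑ s ∈ ({(a₀, a₀)} : Finset (ℕ × ℕ)), ((if s = (a₀, a₀) then 1 else 0 : ℕ) : ℝ) *
        Real.log ((if s = (a₀, a₀) then 1 else 0 : ℕ) : ℝ) +
      ∑ s ∈ ({(a₀, a₀)} : Finset (ℕ × ℕ)), ((if s = (a₀, a₀) then 1 else 0 : ℕ) : ℝ) * Real.log z) /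
      (((1 : ℕ) : ℝ) * a * b) = Real.log z / ((a : ℝ) * b) := by
    simp
  rw [e] at h
  exact h

/-- **Purity-box pressure floor along EVERY `Ls → ∞`** (all-tori version of `eventually_pressureFloor_of_purityBox`):
a density matrix `ρ` on the `(a₀,a₀)` sector of the open `a × b` box (`a, b ≥ 1`, `n (ab) = 2a₀`, `n ≤ 2`) with
`Re tr(ρ H^open|_{(a₀,a₀)}) ≤ E` and purity `Re tr(ρ²) ≤ P`, `β ≥ 0`. Then for every `ε > 0`, eventually
`(−(log P + βE)/(ab) − ε)(Ls j)² ≤ log Re Z_β(sectorHamiltonianTT' t t' U n (Ls j))` along ANY `Ls → ∞`.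
[cite: Ruelle1969, §3.3 (3.11)–(3.18)] [cite: Israel1979, Lemma II.3.1] -/
theorem eventually_pressureFloor_of_purityBox_allTori (t t' U n : ℝ) {β : ℝ} (hβ : 0 ≤ β) {Ls : ℕ → ℕ}
    (hLs : Tendsto Ls atTop atTop) {a b a₀ : ℕ} (ha : 1 ≤ a) (hb : 1 ≤ b) (hn : n * ((a : ℝ) * b) = 2 * a₀)
    (hn2 : n ≤ 2)
    {ρ : Matrix (Subtype (spinConfig (Λ := Fin a ×ₗ Fin b) a₀ a₀))
      (Subtype (spinConfig (Λ := Fin a ×ₗ Fin b) a₀ a₀)) ℂ}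
    (hρ : ρ.PosSemidef) (htr : ρ.trace = 1) {E P : ℝ}
    (hE : (ρ * spinSectorHamiltonian a₀ a₀ (hubbardOpenBoxTT' a b t t' U)).trace.re ≤ E)
    (hP : (ρ * ρ).trace.re ≤ P) {ε : ℝ} (hε : 0 < ε) :
    ∀ᶠ j in atTop, (-(Real.log P + β * E) / ((a : ℝ) * b) - ε) * (Ls j : ℝ) ^ 2 ≤
      Real.log (partitionFn β (sectorHamiltonianTT' t t' U n (Ls j))).re := by
  have hH : (spinSectorHamiltonian a₀ a₀ (hubbardOpenBoxTT' a b t t' U)).IsHermitian :=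
    isHermitian_spinSectorHamiltonian a₀ a₀ (hubbardOpenBoxTT'_isHermitian a b t t' U)
  have hz := exp_neg_log_purity_sub_mul_energy_le_partitionFn hH hβ hρ htr hE hP
  have h := eventually_pressureFloor_of_openBox_allTori t t' U n hβ ha hb hn hn2 (Real.exp_pos _) hz hLs hε
  have e : Real.log (Real.exp (-Real.log P - β * E)) / ((a : ℝ) * b) = -(Real.log P + β * E) / ((a : ℝ) * b) := by
    rw [Real.log_exp]; ring
  rw [e] at h
  exact h

/-- **Two-box chord pressure floor along EVERY `Ls → ∞`** (the `hW` shape of the two-box free-energy producers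
at a NON-commensurate filling): two sectors `(p₁,p₁)`, `(p₂,p₂)` (`p₁ < p₂`) of the open `a × b` box with certified
floors `0 < z_i ≤ Re Z_β(H^open_{a×b}; p_i, p_i)` (`β ≥ 0`), `λ ∈ [0,1]` and the density
`n (ab) = 2((1−λ)p₁ + λp₂) < 2`. Then for every `ε > 0`, eventually
`((1−λ) log z₁/(ab) + λ log z₂/(ab) − ε)(Ls j)² ≤ log Re Z_β(sectorHamiltonianTT' t t' U n (Ls j))` — the chord of
the two single-box floors, from `InfVolFermionState.eventually_typeFreeEntropy_chord_mul_sq_le_log_partitionFn_allTori`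
with the two base types `δ_{(p₁,p₁)}`, `δ_{(p₂,p₂)}`. [cite: Ruelle1969, §3.3 (3.11)–(3.18)] [cite: Israel1979, Lemma II.3.1] -/
theorem eventually_pressureFloor_of_twoBoxes_allTori (t t' U n : ℝ) {β : ℝ} (hβ : 0 ≤ β) {a b p₁ p₂ : ℕ}
    (ha : 1 ≤ a) (hb : 1 ≤ b) (hp : p₁ < p₂) {lam : ℝ} (hlam0 : 0 ≤ lam) (hlam1 : lam ≤ 1)
    (hn : n * ((a : ℝ) * b) = 2 * ((1 - lam) * p₁ + lam * p₂)) (hn2 : n < 2) {z₁ z₂ : ℝ} (hz₁0 : 0 < z₁)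
    (hz₁ : z₁ ≤ (partitionFn β (spinSectorHamiltonian p₁ p₁ (hubbardOpenBoxTT' a b t t' U))).re) (hz₂0 : 0 < z₂)
    (hz₂ : z₂ ≤ (partitionFn β (spinSectorHamiltonian p₂ p₂ (hubbardOpenBoxTT' a b t t' U))).re)
    {Ls : ℕ → ℕ} (hLs : Tendsto Ls atTop atTop) {ε : ℝ} (hε : 0 < ε) :
    ∀ᶠ j in atTop, ((1 - lam) * (Real.log z₁ / ((a : ℝ) * b)) + lam * (Real.log z₂ / ((a : ℝ) * b)) - ε) *
        (Ls j : ℝ) ^ 2 ≤ Real.log (partitionFn β (sectorHamiltonianTT' t t' U n (Ls j))).re := by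
  classical
  have hne : (p₁, p₁) ≠ (p₂, p₂) := fun h => (Nat.ne_of_lt hp) (Prod.mk.inj h).1
  have hne' : (p₂, p₂) ≠ (p₁, p₁) := hne.symm
  have h := InfVolFermionState.eventually_typeFreeEntropy_chord_mul_sq_le_log_partitionFn_allTori t t' U n hβ ha hb
    ({(p₁, p₁), (p₂, p₂)} : Finset (ℕ × ℕ)) (fun s => if s = (p₁, p₁) then 1 else 0)
    (fun s => if s = (p₂, p₂) then 1 else 0) (q₁ := 1) (q₂ := 1) (A₁ := p₁) (A₂ := p₂) le_rfl le_rfl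
    (fun s hs => by
      by_cases h : s = (p₁, p₁)
      · rw [h]; exact Finset.mem_insert_self _ _
      · exact absurd (if_neg h) hs)
    (fun s hs => by
      by_cases h : s = (p₂, p₂)
      · rw [h]; exact Finset.mem_insert_of_mem (Finset.mem_singleton_self _)
      · exact absurd (if_neg h) hs)
    (by simp [Finset.sum_pair hne, hne']) (by simp [Finset.sum_pair hne, hne])
    (by simp [Finset.sum_pair hne, hne']) (by simp [Finset.sum_pair hne, hne'])
    (by simp [Finset.sum_pair hne, hne]) (by simp [Finset.sum_pair hne, hne])
    (by simpa using hp.le) hlam0 hlam1 (by push_cast; linarith) hn2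
    (z := fun s => if s = (p₁, p₁) then z₁ else z₂)
    (fun s hs => by
      show 0 < (if s = (p₁, p₁) then z₁ else z₂)
      split_ifs
      · exact hz₁0
      · exact hz₂0)
    (fun s hs => by
      rcases Finset.mem_insert.1 hs with h1 | h2
      · subst h1; simpa using hz₁
      · rw [Finset.mem_singleton.1 h2]; simpa [hne'] using hz₂) hLs hε
  have e : ((1 - lam) * ((((1 : ℕ) : ℝ) * Real.log ((1 : ℕ) : ℝ) -
        ∑ s ∈ ({(p₁, p₁), (p₂, p₂)} : Finset (ℕ × ℕ)), ((if s = (p₁, p₁) then 1 else 0 : ℕ) : ℝ) *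
          Real.log ((if s = (p₁, p₁) then 1 else 0 : ℕ) : ℝ) +
        ∑ s ∈ ({(p₁, p₁), (p₂, p₂)} : Finset (ℕ × ℕ)), ((if s = (p₁, p₁) then 1 else 0 : ℕ) : ℝ) *
          Real.log (if s = (p₁, p₁) then z₁ else z₂)) / (((1 : ℕ) : ℝ) * a * b)) +
      lam * ((((1 : ℕ) : ℝ) * Real.log ((1 : ℕ) : ℝ) -
        ∑ s ∈ ({(p₁, p₁), (p₂, p₂)} : Finset (ℕ × ℕ)), ((if s = (p₂, p₂) then 1 else 0 : ℕ) : ℝ) *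
          Real.log ((if s = (p₂, p₂) then 1 else 0 : ℕ) : ℝ) +
        ∑ s ∈ ({(p₁, p₁), (p₂, p₂)} : Finset (ℕ × ℕ)), ((if s = (p₂, p₂) then 1 else 0 : ℕ) : ℝ) *
          Real.log (if s = (p₁, p₁) then z₁ else z₂)) / (((1 : ℕ) : ℝ) * a * b))) =
      (1 - lam) * (Real.log z₁ / ((a : ℝ) * b)) + lam * (Real.log z₂ / ((a : ℝ) * b)) := by
    simp [Finset.sum_pair hne, hne, hne']
  rw [e] at h
  exact h

namespace InfVolFermionState

variable {t t' U n β : ℝ} {ω : InfVolFermionState 2} {Ls : ℕ → ℕ}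

/-! ### §2 The rows and the upper edge with a purity-box input, every torus limit -/

/-- **The «ent» row with a purity-box free-energy input, EVERY torus limit.** `ω` a torus limit of the canonical
sector Gibbs states at `β > 0` along ANY `Ls → ∞` (`0 ≤ n ≤ 2`), purity-box data `(a, b, a₀, ρ, E, P)` with
`n (ab) = 2a₀`, a rectangle `B = ∏[0,m_i)` and a Hermitian witness `G ∈ 𝔄_B`:
`e_Φ(ω) − Re ω_B(G)/(β|B|) ≤ (log P + βE)/(β ab) + log Re Tr e^{−G}/(β|B|)`.
[cite: Israel1979, Lemma II.3.1] [cite: ArakiMoriya2003, Theorem 3.8 and §10] -/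
theorem IsTorusLimitOfMixture.meanEnergy_sub_re_expect_div_le_of_sectorGibbs_box_of_purityBox_allTori
    (hn0 : 0 ≤ n) (hn2 : n ≤ 2) (hβ : 0 < β)
    (h : ω.IsTorusLimitOfMixture (sectorGibbsCount n) (fun L => sectorGibbsWeightTT' β t t' U n L)
      (fun L => sectorGibbsVectorTT' t t' U n L) Ls)
    (hLs : Tendsto Ls atTop atTop) {a b a₀ : ℕ} (ha : 1 ≤ a) (hb : 1 ≤ b) (hn : n * ((a : ℝ) * b) = 2 * a₀)
    {ρ : Matrix (Subtype (spinConfig (Λ := Fin a ×ₗ Fin b) a₀ a₀))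
      (Subtype (spinConfig (Λ := Fin a ×ₗ Fin b) a₀ a₀)) ℂ}
    (hρ : ρ.PosSemidef) (htr : ρ.trace = 1) {E P : ℝ}
    (hE : (ρ * spinSectorHamiltonian a₀ a₀ (hubbardOpenBoxTT' a b t t' U)).trace.re ≤ E)
    (hP : (ρ * ρ).trace.re ≤ P)
    {m : Fin 2 → ℕ} (hm : ∀ i, 0 < m i) {G : FermionOp (halfOpenRect m)} (hG : G.IsHermitian) :
    ω.meanEnergy (hubbardTTPrimeFermionInteraction t t' U) 1 -
        1 / (β * ∏ i, (m i : ℝ)) * (ω.expect (halfOpenRect m) G).re ≤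
      (Real.log P + β * E) / (β * ((a : ℝ) * b)) + Real.log (partitionFn 1 G).re / (β * ∏ i, (m i : ℝ)) := by
  have hrow := h.meanEnergy_sub_re_expect_div_le_of_sectorGibbs_box_of_pressureFloor t t' U hn0 hn2 hβ hLs
    (fun ε hε => eventually_pressureFloor_of_purityBox_allTori t t' U n hβ.le hLs ha hb hn hn2 hρ htr hE hP hε)
    hm hG
  exact hrow.trans (le_of_eq (by ring))

/-- **The «cent» row with a purity-box free-energy input, EVERY torus limit.** Same `ω` and box data; a window
`Λ ⊆ [0,ℓ)²` with lexicographically largest site `a'`, `H ∈ 𝔄_Λ` and a conditional free-energy bound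
`∀σ: S(σ) − S(σ_{Λ∖a'}) − Re tr(σH) ≤ c`: `e_Φ(ω) − Re ω_Λ(H)/β ≤ (log P + βE)/(β ab) + c/β`.
[cite: PoulinHastings2011, eqs. (3)–(8)] [cite: Israel1979, Lemma II.3.1] -/
theorem IsTorusLimitOfMixture.meanEnergy_sub_re_expect_div_le_of_sectorGibbs_window_of_purityBox_allTori
    (hn0 : 0 ≤ n) (hn2 : n ≤ 2) (hβ : 0 < β)
    (h : ω.IsTorusLimitOfMixture (sectorGibbsCount n) (fun L => sectorGibbsWeightTT' β t t' U n L)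
      (fun L => sectorGibbsVectorTT' t t' U n L) Ls)
    (hLs : Tendsto Ls atTop atTop) {a b a₀ : ℕ} (ha : 1 ≤ a) (hb : 1 ≤ b) (hn : n * ((a : ℝ) * b) = 2 * a₀)
    {ρ : Matrix (Subtype (spinConfig (Λ := Fin a ×ₗ Fin b) a₀ a₀))
      (Subtype (spinConfig (Λ := Fin a ×ₗ Fin b) a₀ a₀)) ℂ}
    (hρ : ρ.PosSemidef) (htr : ρ.trace = 1) {E P : ℝ}
    (hE : (ρ * spinSectorHamiltonian a₀ a₀ (hubbardOpenBoxTT' a b t t' U)).trace.re ≤ E)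
    (hP : (ρ * ρ).trace.re ≤ P)
    {Λ : Finset (Site 2)} {a' : Site 2} (ha' : a' ∈ Λ) (hmax : ∀ y ∈ Λ, toLex y ≤ toLex a') {ℓ : ℕ}
    (hΛ : Λ ⊆ halfOpenBox 2 ℓ) (H : FermionOp Λ) {c : ℝ}
    (hrow : ∀ σ : FermionOp Λ, σ.PosSemidef → σ.trace = 1 →
      vonNeumannEntropy σ - vonNeumannEntropy (fermionPartialTrace (PolySite.incl (Finset.erase_subset a' Λ)) σ) -
        (σ * H).trace.re ≤ c) :
    ω.meanEnergy (hubbardTTPrimeFermionInteraction t t' U) 1 - 1 / β * (ω.expect Λ H).re ≤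
      (Real.log P + β * E) / (β * ((a : ℝ) * b)) + c / β := by
  have hrow' := h.meanEnergy_sub_re_expect_div_le_of_sectorGibbs_window_of_pressureFloor t t' U hn0 hn2 hβ hLs
    (fun ε hε => eventually_pressureFloor_of_purityBox_allTori t t' U n hβ.le hLs ha hb hn hn2 hρ htr hE hP hε)
    ha' hmax hΛ H hrow
  exact hrow'.trans (le_of_eq (by ring))

/-- **Certified upper edge of the thermal energy window from an entropy-certified box state, EVERY torus limit**
(all-tori version of `…meanEnergy_hubbardTTPrime_le_chord_of_purityBox`): `ω` a torus limit at `β` along ANY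
`Ls → ∞` (`0 ≤ n ≤ 2`), purity-box data `(a, b, a₀, ρ, E, P)` with `n (ab) = 2a₀`, and an eventual hot bound
`log Re Z_{β_h}^{sector}(Ls j) ≤ u_h (Ls j)²` (`0 < β_h < β`). Then `e_Φ(ω) ≤ (u_h + (log P + βE)/(ab))/(β − β_h)`.
[cite: Israel1979, Lemma II.3.1] [cite: Ruelle1969, §3.3 (3.11)–(3.18)] -/
theorem IsTorusLimitOfMixture.meanEnergy_hubbardTTPrime_le_chord_of_purityBox_allTori
    (hn0 : 0 ≤ n) (hn2 : n ≤ 2)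
    (h : ω.IsTorusLimitOfMixture (sectorGibbsCount n) (fun L => sectorGibbsWeightTT' β t t' U n L)
      (fun L => sectorGibbsVectorTT' t t' U n L) Ls)
    (hLs : Tendsto Ls atTop atTop) {βh : ℝ} (hβh : 0 < βh) (hlt : βh < β)
    {a b a₀ : ℕ} (ha : 1 ≤ a) (hb : 1 ≤ b) (hn : n * ((a : ℝ) * b) = 2 * a₀)
    {ρ : Matrix (Subtype (spinConfig (Λ := Fin a ×ₗ Fin b) a₀ a₀))
      (Subtype (spinConfig (Λ := Fin a ×ₗ Fin b) a₀ a₀)) ℂ}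
    (hρ : ρ.PosSemidef) (htr : ρ.trace = 1) {E P : ℝ}
    (hE : (ρ * spinSectorHamiltonian a₀ a₀ (hubbardOpenBoxTT' a b t t' U)).trace.re ≤ E)
    (hP : (ρ * ρ).trace.re ≤ P) {uh : ℝ}
    (huh : ∀ᶠ j in atTop, Real.log (partitionFn βh (sectorHamiltonianTT' t t' U n (Ls j))).re ≤
      uh * (Ls j : ℝ) ^ 2) :
    ω.meanEnergy (hubbardTTPrimeFermionInteraction t t' U) 1 ≤
      (uh + (Real.log P + β * E) / ((a : ℝ) * b)) / (β - βh) := by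
  have hβ : 0 ≤ β := (hβh.trans hlt).le
  have hu : ∀ ε : ℝ, 0 < ε → ∀ᶠ j in atTop,
      Real.log (partitionFn βh (sectorHamiltonianTT' t t' U n (Ls j))).re ≤ (uh + ε) * (Ls j : ℝ) ^ 2 := by
    intro ε hε
    filter_upwards [huh] with j hj
    have h2 : (0 : ℝ) ≤ (Ls j : ℝ) ^ 2 := by positivity
    nlinarith
  have hmain := h.meanEnergy_hubbardTTPrime_le_of_eventually_pressure_bounds hn0 hn2 hLs hβh hlt
    (fun ε hε => eventually_pressureFloor_of_purityBox_allTori t t' U n hβ hLs ha hb hn hn2 hρ htr hE hP hε) hu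
  refine hmain.trans (le_of_eq ?_)
  congr 1
  ring

/-- **«ent» row at `n = 7/8` with a `4 × 4` purity box, along ANY `Ls → ∞`** (no `Ls j = 4(j+2)`): for every
torus limit `ω` of the canonical sector Gibbs states on `(N↑ = N↓ = ⌊7L²/16⌋)` at `β > 0` along any `Ls → ∞`,
every density matrix `ρ` on the `(7,7)` sector of the open `4 × 4` box with `Re tr(ρH) ≤ E`, `Re tr(ρ²) ≤ P`, every
rectangle `B` and Hermitian witness `G ∈ 𝔄_B`:
`e_Φ(ω) − Re ω_B(G)/(β|B|) ≤ (log P + βE)/(16β) + log Re Tr e^{−G}/(β|B|)`. [cite: LeBlancEtAl2015, eq. (1)]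
[cite: Israel1979, Lemma II.3.1] -/
theorem IsTorusLimitOfMixture.meanEnergy_sub_re_expect_div_le_of_sectorGibbs_box_of_purityBox_seven_eighths_allTori
    (hβ : 0 < β) (hLs : Tendsto Ls atTop atTop)
    (h : ω.IsTorusLimitOfMixture (sectorGibbsCount (7 / 8)) (fun L => sectorGibbsWeightTT' β t t' U (7 / 8) L)
      (fun L => sectorGibbsVectorTT' t t' U (7 / 8) L) Ls)
    {ρ : Matrix (Subtype (spinConfig (Λ := Fin 4 ×ₗ Fin 4) 7 7)) (Subtype (spinConfig (Λ := Fin 4 ×ₗ Fin 4) 7 7)) ℂ}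
    (hρ : ρ.PosSemidef) (htr : ρ.trace = 1) {E P : ℝ}
    (hE : (ρ * spinSectorHamiltonian 7 7 (hubbardOpenBoxTT' 4 4 t t' U)).trace.re ≤ E)
    (hP : (ρ * ρ).trace.re ≤ P)
    {m : Fin 2 → ℕ} (hm : ∀ i, 0 < m i) {G : FermionOp (halfOpenRect m)} (hG : G.IsHermitian) :
    ω.meanEnergy (hubbardTTPrimeFermionInteraction t t' U) 1 -
        1 / (β * ∏ i, (m i : ℝ)) * (ω.expect (halfOpenRect m) G).re ≤
      (Real.log P + β * E) / (β * 16) + Real.log (partitionFn 1 G).re / (β * ∏ i, (m i : ℝ)) := by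
  have h16 := h.meanEnergy_sub_re_expect_div_le_of_sectorGibbs_box_of_purityBox_allTori (by norm_num) (by norm_num)
    hβ hLs (a := 4) (b := 4) (a₀ := 7) (by norm_num) (by norm_num) (by norm_num) hρ htr hE hP hm hG
  norm_num at h16 ⊢
  exact h16

end InfVolFermionState

end Literature.MathematicalPhysics.QuantumLattice

end
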